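import Summits.BirchSwinnertonDyer.BirchSwinnertonDyer.Theorems.KatoDescentTamePotSupersingularCartanMuRoadSplitFiveAbelDoors
import Summits.BirchSwinnertonDyer.BirchSwinnertonDyer.Theorems.KatoDescentTamePotSupersingularTameUpperUnitTwistRecordsSharp35
import HarnessLib

/-!
# Route `KatoDescentTamePotSupersingular` (rung K8, sub-rung B4 (t′), cell `bsd-potss`): (A) and U₀ RECORDS for the KT (A)@5 RESIDUE ROW `235200xb1`
# by the FW-free split-Cartan μ-road with a FUKUDA (0,1) leaf at `ℚ(P)` (seat `bsd-potss-k8t-c4` g27; `--supports stmt-BirchSwinnertonDyer-19982 --as helper`)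

HONEST FRAMING. THEOREMS ONLY (no definition, no named fact, no `sorry`); PER ROW — not a class theorem; nothing is booked; items 19202 / 19982 /
19413 / 19916 stay OPEN at class level (class-wide open inputs: the zeta crux 24439 and the lower half of the residual 19984); Coates–Sujatha (A),
Conjecture A and BSD are proved for no curve here. WHY THIS ROW: `235200xb1` (`N = 2^6·3·5^2·7^2`, Cremona `r_an = 0`, (t′) at `5` with `e = 3`,
mod-`5` image `5Ns` = normaliser of a split Cartan, ♯ row, `ord₅ #Ш_an = 0`) is one of the five KT p = 5 rows WITHOUT any (A)-bearing record after
k8t-c4 g26 / g27: the layer-0 roads are shut (`5 ∣ h(ℚ(P)) = 80`, certified; an `E[5]`-ISOTYPIC 5-class at layer 0, g26 kit j334494), the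
Selmer-trivial road is shut ((c3) fails: split multiplicative at `3` with `5 ∣ v_3(Δ)`, see the erratum of `…TameFineSelmerTrivialRecords03`), and
the Iwasawa-1956 class-data door `CartanMuRoadSplitFiveAbelDoors.conjA_five_of_splitCartanBasis_of_classData` needs `5 ∤ h(ℚ(P))`. conjA-anchor g15
RESOLVED the row numerically (RESULTS 11, kit j312330, cross-check j309704): on the cyclotomic `ℤ_5`-tower of `K = ℚ(P)` (degree 8) the first layer
`K₁` (degree 40) has `h = 14080`, `Cl(K₁)[5^∞] = ℤ/5 = Cl(K)[5^∞]` (GRH at degree 40) — Fukuda 1994 Thm. 1 at layers (0,1) ⇒ `μ(K_cyc/K) = 0`.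
THIS FILE lands that resolution: the six-leaf μ-form door `conjA_five_of_splitCartanBasis_of_mu6` (k8t-c4 g24, FW-free, `hCS` a tree theorem) with
* leaf `ℚ(P) = L^⟨σ̄_v⟩`: Fukuda (2) in RANK form at layers `(0,1)` — displayed `hrkP : rank₅ Cl(K₁) = rank₅ Cl(K)` (= `1 = 1`, j312330, GRH) through
  `CartanMuRoadSplitFiveAbelDoors.leafMu_of_rankSuccEqAt` (total ramification from layer 0 KERNEL for subfields of `ℚ(W[5])`, `5 ∤ #Gal`);
* leaves `L^⟨σ̄_u²σ̄_v⟩` (deg 8, `h = 16`), `ℚ(C) = L^⟨σ̄_uσ̄_v, σ̄_w⟩` (`x⁴−x²−1`, `h = 1`), `K′ = L^⟨σ̄_uσ̄_v⁻¹, σ̄_w⟩` (`x⁴−5x²+5 = ℚ(ζ₂₀)⁺`, `h = 1`),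
  `Z = L^⟨σ̄_uσ̄_v⁻¹, σ̄_u²σ̄_w⟩` (`≅ ℚ(ζ₅)`, `h = 1`): Iwasawa 1956 (PROVED) from «`5 ∤ h`» + «one prime above 5» — all four CERTIFIED (`bnfcertify`) with
  exactly one prime above `5` (kit **j336751**, g24's engine `unitidx_abel.gp` v2.1 on this row: `Dq [[8,1]]`, `C [[2,2]]`, `K′ [[4,1]]`, `Z [[4,1]]`);
* leaf `Q₂ = L^⟨σ̄_uσ̄_v⁻¹, σ̄_wσ̄_u⟩ = ℚ(i)` (j336751: `x² + 1`; `5` splits, layers (0,1) GROW): Fukuda (2) at layers `(1,2)` — displayed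
  `hrkQ : rank₅ Cl((Q₂)₂) = rank₅ Cl((Q₂)₁)` (= `1 = 1`; k8t-c4 g24 kit j327926 GRH at degree 50, with the GRH-FREE derivation of g24's memo §3
  (analytic class number formula + genus theory: `Cl(ℚ(i)ℚ_n)[5^∞] ≅ ℤ/5ⁿ`, n ≤ 3) — the SAME datum as in g24's records `…MuRoadFiveRecordsSplitAbel01/02`).
Displayed besides: the split-Cartan basis data (`e he σu σv σw`; image type `5Ns` = LMFDB / census, not certified). KERNEL (k8t-c4 g14, file
`…TameUpperUnitTwistRecordsSharp35`): `Δ ≠ 0`, minimality, `E[5]` irreducible, `Addv E 5`, `SubTprime E 5`. U₀ twin modulo `hKatoA hGZK hmod` only.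
EFFECT on the census: KT (A)@5 residue 5 → 4 rows (119025ck1, 396900eb1 [kit j336694 running], 338800ex1 [same road needs two uncomputed data:
Fukuda at `ℚ(P)` layer 1 (degree 40) and at `Q₂ = ℚ(√−11)` layers ≥ (1,2) (degree 50) — j336751], 110450bj1).

References: [CoatesSujatha2005] Thm. 3.4; [Fukuda1994] Thm. 1 (2), p. 264; [Greenberg2001IwasawaPastPresent] Prop. (2.1); [Serre1972] §2.2, §2.4 Prop. 15;
[Washington1997] §13.1; [Kato2004Asterisque] Thm. 14.5 (3), 12.5 (3); [Miller2011LMS] Def. 1.1; [Cremona2006] Table 1 (235200xb1).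
-/

set_option autoImplicit false
set_option linter.dupNamespace false

noncomputable section

open scoped Classical NumberField Matrix
open WeierstrassCurve Field IntermediateField
  Literature.NumberTheory.EllipticCurves Literature.NumberTheory.EllipticCurves.Rank1Residual
  Literature.NumberTheory.EllipticCurves.Rank1Residual.Typed
  Literature.NumberTheory.GaloisRepresentations Literature.NumberTheory.SerreUniformity Literature.NumberTheory.IwasawaTheory
  Summit.BirchSwinnertonDyer.Rank1Residual Summit.BirchSwinnertonDyer.Rank1Residual.Additive
  Summit.BirchSwinnertonDyer.BirchSwinnertonDyer.Theorems Summit.BirchSwinnertonDyer.BirchSwinnertonDyer.Theorems.TameUpperUnitTwistRecords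

namespace Summit.BirchSwinnertonDyer.BirchSwinnertonDyer.Theorems.TameConjAFiveRecords

/-- **RECORD — Coates–Sujatha (A) at `(E, 5)` for `E = 235200xb1` by the FW-free split-Cartan μ-road with a Fukuda (0,1) leaf at `ℚ(P)`** — NO named
fact: displayed the split-Cartan basis data, `hrkP` (Fukuda rank equality at layers (0,1) on `ℚ(P)`: conjA-anchor j312330, GRH), the certified
Iwasawa-1956 class data of the four leaves `L^⟨σ̄_u²σ̄_v⟩`, `ℚ(C)`, `K′`, `Z` (kit j336751) and `hrkQ` (Fukuda rank equality at layers (1,2) on `Q₂ = ℚ(i)`,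
k8t-c4 g24 j327926 / memo §3); KERNEL `irr_g235200xb1_5` and the total ramification of the leaves' towers. Per row; nothing booked; (A) asserted for
no class. [cite: CoatesSujatha2005, Thm. 3.4 (§3)] [cite: Fukuda1994, Thm. 1 (2), p. 264] [cite: Greenberg2001IwasawaPastPresent, Prop. (2.1) (p. 339)]
[cite: Serre1972, §2.4 Prop. 15] [cite: Cremona2006, Table 1 (Cremona label 235200xb1)] -/
theorem conjA_g235200xb1_5_abelFukudaP
    {W : WeierstrassCurve ℚ} [W.IsElliptic] (hWeq : W = (⟨0, 1, 0, (-224583), 40910463⟩ : WeierstrassCurve ℚ))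
    (e : W.geomTorsion (5 : ℕ) ≃+ (Fin 2 → ZMod 5))
    (he : ∀ σ : absoluteGaloisGroup ℚ, ∃ M ∈ splitCartanNormalizer 5, ∀ P : W.geomTorsion (5 : ℕ), e (σ • P) = M *ᵥ e P)
    (σu σv σw : absoluteGaloisGroup ℚ) (hσu : ∀ P : W.geomTorsion (5 : ℕ), e (σu • P) = !![2, 0; 0, 1] *ᵥ e P)
    (hσv : ∀ P : W.geomTorsion (5 : ℕ), e (σv • P) = !![1, 0; 0, 2] *ᵥ e P)
    (hσw : ∀ P : W.geomTorsion (5 : ℕ), e (σw • P) = !![0, 1; 1, 0] *ᵥ e P)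
    (hrkP : haveI : NumberField ↥(W.divisionField 5) := NumberField.mk
      ∀ κE : ZpExtension ↥(fixedField (Subgroup.zpowers (absRestrictNormalHom (W.divisionField 5) σv))) 5,
        κE.IsCyclotomic → classGroupPRank κE (0 + 1) = classGroupPRank κE 0)
    (hhD : haveI : NumberField ↥(W.divisionField 5) := NumberField.mk
      ¬ 5 ∣ NumberField.classNumber ↥(fixedField (Subgroup.zpowers (absRestrictNormalHom (W.divisionField 5) σu *
        absRestrictNormalHom (W.divisionField 5) σu * absRestrictNormalHom (W.divisionField 5) σv))))
    (hvD : haveI : NumberField ↥(W.divisionField 5) := NumberField.mk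
      ∃! v : IsDedekindDomain.HeightOneSpectrum (𝓞 ↥(fixedField (Subgroup.zpowers (absRestrictNormalHom (W.divisionField 5) σu *
        absRestrictNormalHom (W.divisionField 5) σu * absRestrictNormalHom (W.divisionField 5) σv)))),
        ((5 : ℕ) : 𝓞 ↥(fixedField (Subgroup.zpowers (absRestrictNormalHom (W.divisionField 5) σu *
        absRestrictNormalHom (W.divisionField 5) σu * absRestrictNormalHom (W.divisionField 5) σv)))) ∈ v.asIdeal)
    (hhC : haveI : NumberField ↥(W.divisionField 5) := NumberField.mk
      ¬ 5 ∣ NumberField.classNumber ↥(fixedField (Subgroup.zpowers (absRestrictNormalHom (W.divisionField 5) σu *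
        absRestrictNormalHom (W.divisionField 5) σv) ⊔ Subgroup.zpowers (absRestrictNormalHom (W.divisionField 5) σw))))
    (hvC : haveI : NumberField ↥(W.divisionField 5) := NumberField.mk
      ∃! v : IsDedekindDomain.HeightOneSpectrum (𝓞 ↥(fixedField (Subgroup.zpowers (absRestrictNormalHom (W.divisionField 5) σu *
        absRestrictNormalHom (W.divisionField 5) σv) ⊔ Subgroup.zpowers (absRestrictNormalHom (W.divisionField 5) σw)))),
        ((5 : ℕ) : 𝓞 ↥(fixedField (Subgroup.zpowers (absRestrictNormalHom (W.divisionField 5) σu *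
        absRestrictNormalHom (W.divisionField 5) σv) ⊔ Subgroup.zpowers (absRestrictNormalHom (W.divisionField 5) σw)))) ∈ v.asIdeal)
    (hhK : haveI : NumberField ↥(W.divisionField 5) := NumberField.mk
      ¬ 5 ∣ NumberField.classNumber ↥(fixedField (Subgroup.zpowers (absRestrictNormalHom (W.divisionField 5) σu *
        (absRestrictNormalHom (W.divisionField 5) σv)⁻¹) ⊔ Subgroup.zpowers (absRestrictNormalHom (W.divisionField 5) σw))))
    (hvK : haveI : NumberField ↥(W.divisionField 5) := NumberField.mk
      ∃! v : IsDedekindDomain.HeightOneSpectrum (𝓞 ↥(fixedField (Subgroup.zpowers (absRestrictNormalHom (W.divisionField 5) σu *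
        (absRestrictNormalHom (W.divisionField 5) σv)⁻¹) ⊔ Subgroup.zpowers (absRestrictNormalHom (W.divisionField 5) σw)))),
        ((5 : ℕ) : 𝓞 ↥(fixedField (Subgroup.zpowers (absRestrictNormalHom (W.divisionField 5) σu *
        (absRestrictNormalHom (W.divisionField 5) σv)⁻¹) ⊔ Subgroup.zpowers (absRestrictNormalHom (W.divisionField 5) σw)))) ∈ v.asIdeal)
    (hhZ : haveI : NumberField ↥(W.divisionField 5) := NumberField.mk
      ¬ 5 ∣ NumberField.classNumber ↥(fixedField (Subgroup.zpowers (absRestrictNormalHom (W.divisionField 5) σu *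
        (absRestrictNormalHom (W.divisionField 5) σv)⁻¹) ⊔ Subgroup.zpowers (absRestrictNormalHom (W.divisionField 5) σu *
        absRestrictNormalHom (W.divisionField 5) σu * absRestrictNormalHom (W.divisionField 5) σw))))
    (hvZ : haveI : NumberField ↥(W.divisionField 5) := NumberField.mk
      ∃! v : IsDedekindDomain.HeightOneSpectrum (𝓞 ↥(fixedField (Subgroup.zpowers (absRestrictNormalHom (W.divisionField 5) σu *
        (absRestrictNormalHom (W.divisionField 5) σv)⁻¹) ⊔ Subgroup.zpowers (absRestrictNormalHom (W.divisionField 5) σu *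
        absRestrictNormalHom (W.divisionField 5) σu * absRestrictNormalHom (W.divisionField 5) σw)))),
        ((5 : ℕ) : 𝓞 ↥(fixedField (Subgroup.zpowers (absRestrictNormalHom (W.divisionField 5) σu *
        (absRestrictNormalHom (W.divisionField 5) σv)⁻¹) ⊔ Subgroup.zpowers (absRestrictNormalHom (W.divisionField 5) σu *
        absRestrictNormalHom (W.divisionField 5) σu * absRestrictNormalHom (W.divisionField 5) σw)))) ∈ v.asIdeal)
    (hrkQ : haveI : NumberField ↥(W.divisionField 5) := NumberField.mk
      ∀ κE : ZpExtension ↥(fixedField (Subgroup.zpowers (absRestrictNormalHom (W.divisionField 5) σu *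
        (absRestrictNormalHom (W.divisionField 5) σv)⁻¹) ⊔ Subgroup.zpowers (absRestrictNormalHom (W.divisionField 5) σw *
        absRestrictNormalHom (W.divisionField 5) σu))) 5,
        κE.IsCyclotomic → classGroupPRank κE (1 + 1) = classGroupPRank κE 1)
    (κ : ZpExtension ℚ 5) (hκ : κ.IsCyclotomic) :
    ∃ (γ : absoluteGaloisGroup ℚ) (Df : W.FineSelmerDualData κ γ),
      Module.Finite ℤ_[5] (RestrictScalars ℤ_[5] (IwasawaAlgebra 5) Df.X) := by
  subst hWeq
  haveI : Fact (Nat.Prime 5) := ⟨by norm_num⟩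
  haveI : NumberField ↥((⟨0, 1, 0, (-224583), 40910463⟩ : WeierstrassCurve ℚ).divisionField 5) := NumberField.mk
  have hirr := irr_g235200xb1_5
  exact CartanMuRoadSplitFiveAbelDoors.conjA_five_of_splitCartanBasis_of_mu6 _ e he σu σv σw hσu hσv hσw
    (CartanMuRoadSplitFiveAbelDoors.leafMu_of_rankSuccEqAt _ hirr ⟨e, he⟩ _ 0 hrkP)
    (CartanMuRoadSplitFiveIndexTwoAbelDoors.leafMu_of_classNumber' _ hhD hvD)
    (CartanMuRoadSplitFiveIndexTwoAbelDoors.leafMu_of_classNumber' _ hhC hvC)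
    (CartanMuRoadSplitFiveIndexTwoAbelDoors.leafMu_of_classNumber' _ hhK hvK)
    (CartanMuRoadSplitFiveIndexTwoAbelDoors.leafMu_of_classNumber' _ hhZ hvZ)
    (CartanMuRoadSplitFiveAbelDoors.leafMu_of_rankSuccEqAt _ hirr ⟨e, he⟩ _ 1 hrkQ) κ hκ

/-- **RECORD — UPPER half `ord₅ #Ш(E) ≤ ord₅ #Ш(E)_an` for `E = 235200xb1` at `p = 5` BY THE μ-ROAD, modulo `hKatoA hGZK hmod` ONLY** (U₀-ns row of KT
items 19202 / 19982; a SECOND U₀ road beside g14's ♯ unit-twist record `missingUpperBoundAt_g235200xb1_5`): the (t′) door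
`CartanMuRoadDoorsTprimeFive.missingUpperBoundAt_tame_of_conjA` ∘ `conjA_g235200xb1_5_abelFukudaP`. KERNEL: minimality, `E[5]` irreducible, `Addv E 5`,
`SubTprime E 5` (file `…Sharp35`). DISPLAYED: `hKatoA hGZK hmod`, Cremona's `r_an = 0` (`hr`), the basis and class/rank data of the (A) record. Per row;
CONDITIONAL; nothing booked; BSD is not proved by this. [cite: Kato2004Asterisque, Thm. 14.5 (3) (p. 236), Thm. 12.5 (3) (p. 222)]
[cite: CoatesSujatha2005, Thm. 3.4 (§3)] [cite: Fukuda1994, Thm. 1 (2), p. 264] [cite: Miller2011LMS, Def. 1.1] [cite: Cremona2006, Table 1 (Cremona label 235200xb1)] -/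
theorem missingUpperBoundAt_g235200xb1_5_abelFukudaP
    (hKatoA : Kato2004.rankZero_padicValNat_sha_add_padicValNat_tamagawa_le_of_additive_potGood_of_irreducible_of_fineSelmerDual_fg)
    (hGZK : rank_eq_analyticRank_of_analyticRank_le_one) (hmod : hasEntireLFunction_rat)
    {W : WeierstrassCurve ℚ} [W.IsElliptic] [W.IsGloballyMinimal] (hWeq : W = (⟨0, 1, 0, (-224583), 40910463⟩ : WeierstrassCurve ℚ))
    (hr : W.analyticRank = 0)
    (e : W.geomTorsion (5 : ℕ) ≃+ (Fin 2 → ZMod 5))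
    (he : ∀ σ : absoluteGaloisGroup ℚ, ∃ M ∈ splitCartanNormalizer 5, ∀ P : W.geomTorsion (5 : ℕ), e (σ • P) = M *ᵥ e P)
    (σu σv σw : absoluteGaloisGroup ℚ) (hσu : ∀ P : W.geomTorsion (5 : ℕ), e (σu • P) = !![2, 0; 0, 1] *ᵥ e P)
    (hσv : ∀ P : W.geomTorsion (5 : ℕ), e (σv • P) = !![1, 0; 0, 2] *ᵥ e P)
    (hσw : ∀ P : W.geomTorsion (5 : ℕ), e (σw • P) = !![0, 1; 1, 0] *ᵥ e P)
    (hrkP : haveI : NumberField ↥(W.divisionField 5) := NumberField.mk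
      ∀ κE : ZpExtension ↥(fixedField (Subgroup.zpowers (absRestrictNormalHom (W.divisionField 5) σv))) 5,
        κE.IsCyclotomic → classGroupPRank κE (0 + 1) = classGroupPRank κE 0)
    (hhD : haveI : NumberField ↥(W.divisionField 5) := NumberField.mk
      ¬ 5 ∣ NumberField.classNumber ↥(fixedField (Subgroup.zpowers (absRestrictNormalHom (W.divisionField 5) σu *
        absRestrictNormalHom (W.divisionField 5) σu * absRestrictNormalHom (W.divisionField 5) σv))))
    (hvD : haveI : NumberField ↥(W.divisionField 5) := NumberField.mk
      ∃! v : IsDedekindDomain.HeightOneSpectrum (𝓞 ↥(fixedField (Subgroup.zpowers (absRestrictNormalHom (W.divisionField 5) σu *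
        absRestrictNormalHom (W.divisionField 5) σu * absRestrictNormalHom (W.divisionField 5) σv)))),
        ((5 : ℕ) : 𝓞 ↥(fixedField (Subgroup.zpowers (absRestrictNormalHom (W.divisionField 5) σu *
        absRestrictNormalHom (W.divisionField 5) σu * absRestrictNormalHom (W.divisionField 5) σv)))) ∈ v.asIdeal)
    (hhC : haveI : NumberField ↥(W.divisionField 5) := NumberField.mk
      ¬ 5 ∣ NumberField.classNumber ↥(fixedField (Subgroup.zpowers (absRestrictNormalHom (W.divisionField 5) σu *
        absRestrictNormalHom (W.divisionField 5) σv) ⊔ Subgroup.zpowers (absRestrictNormalHom (W.divisionField 5) σw))))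
    (hvC : haveI : NumberField ↥(W.divisionField 5) := NumberField.mk
      ∃! v : IsDedekindDomain.HeightOneSpectrum (𝓞 ↥(fixedField (Subgroup.zpowers (absRestrictNormalHom (W.divisionField 5) σu *
        absRestrictNormalHom (W.divisionField 5) σv) ⊔ Subgroup.zpowers (absRestrictNormalHom (W.divisionField 5) σw)))),
        ((5 : ℕ) : 𝓞 ↥(fixedField (Subgroup.zpowers (absRestrictNormalHom (W.divisionField 5) σu *
        absRestrictNormalHom (W.divisionField 5) σv) ⊔ Subgroup.zpowers (absRestrictNormalHom (W.divisionField 5) σw)))) ∈ v.asIdeal)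
    (hhK : haveI : NumberField ↥(W.divisionField 5) := NumberField.mk
      ¬ 5 ∣ NumberField.classNumber ↥(fixedField (Subgroup.zpowers (absRestrictNormalHom (W.divisionField 5) σu *
        (absRestrictNormalHom (W.divisionField 5) σv)⁻¹) ⊔ Subgroup.zpowers (absRestrictNormalHom (W.divisionField 5) σw))))
    (hvK : haveI : NumberField ↥(W.divisionField 5) := NumberField.mk
      ∃! v : IsDedekindDomain.HeightOneSpectrum (𝓞 ↥(fixedField (Subgroup.zpowers (absRestrictNormalHom (W.divisionField 5) σu *
        (absRestrictNormalHom (W.divisionField 5) σv)⁻¹) ⊔ Subgroup.zpowers (absRestrictNormalHom (W.divisionField 5) σw)))),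
        ((5 : ℕ) : 𝓞 ↥(fixedField (Subgroup.zpowers (absRestrictNormalHom (W.divisionField 5) σu *
        (absRestrictNormalHom (W.divisionField 5) σv)⁻¹) ⊔ Subgroup.zpowers (absRestrictNormalHom (W.divisionField 5) σw)))) ∈ v.asIdeal)
    (hhZ : haveI : NumberField ↥(W.divisionField 5) := NumberField.mk
      ¬ 5 ∣ NumberField.classNumber ↥(fixedField (Subgroup.zpowers (absRestrictNormalHom (W.divisionField 5) σu *
        (absRestrictNormalHom (W.divisionField 5) σv)⁻¹) ⊔ Subgroup.zpowers (absRestrictNormalHom (W.divisionField 5) σu *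
        absRestrictNormalHom (W.divisionField 5) σu * absRestrictNormalHom (W.divisionField 5) σw))))
    (hvZ : haveI : NumberField ↥(W.divisionField 5) := NumberField.mk
      ∃! v : IsDedekindDomain.HeightOneSpectrum (𝓞 ↥(fixedField (Subgroup.zpowers (absRestrictNormalHom (W.divisionField 5) σu *
        (absRestrictNormalHom (W.divisionField 5) σv)⁻¹) ⊔ Subgroup.zpowers (absRestrictNormalHom (W.divisionField 5) σu *
        absRestrictNormalHom (W.divisionField 5) σu * absRestrictNormalHom (W.divisionField 5) σw)))),
        ((5 : ℕ) : 𝓞 ↥(fixedField (Subgroup.zpowers (absRestrictNormalHom (W.divisionField 5) σu *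
        (absRestrictNormalHom (W.divisionField 5) σv)⁻¹) ⊔ Subgroup.zpowers (absRestrictNormalHom (W.divisionField 5) σu *
        absRestrictNormalHom (W.divisionField 5) σu * absRestrictNormalHom (W.divisionField 5) σw)))) ∈ v.asIdeal)
    (hrkQ : haveI : NumberField ↥(W.divisionField 5) := NumberField.mk
      ∀ κE : ZpExtension ↥(fixedField (Subgroup.zpowers (absRestrictNormalHom (W.divisionField 5) σu *
        (absRestrictNormalHom (W.divisionField 5) σv)⁻¹) ⊔ Subgroup.zpowers (absRestrictNormalHom (W.divisionField 5) σw *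
        absRestrictNormalHom (W.divisionField 5) σu))) 5,
        κE.IsCyclotomic → classGroupPRank κE (1 + 1) = classGroupPRank κE 1) :
    MissingUpperBoundAt W 5 := by
  subst hWeq
  haveI : Fact (Nat.Prime 5) := ⟨by norm_num⟩
  exact CartanMuRoadDoorsTprimeFive.missingUpperBoundAt_tame_of_conjA _ hKatoA hGZK hmod 5 hr (by decide) addv_g235200xb1_5
    subTprime_g235200xb1_5 irr_g235200xb1_5
    (conjA_g235200xb1_5_abelFukudaP rfl e he σu σv σw hσu hσv hσw hrkP hhD hvD hhC hvC hhK hvK hhZ hvZ hrkQ)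

end Summit.BirchSwinnertonDyer.BirchSwinnertonDyer.Theorems.TameConjAFiveRecords

end
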